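import Literature.Analysis.FluidPDE.RadialSolenoidalVanishing
import Literature.Analysis.FluidPDE.SereginSverakPressureMonotone
import Literature.Analysis.FluidPDE.PoincareBall
import Literature.Analysis.FunctionSpaces.SpaceTimeWeakCompactness
import Literature.Analysis.FluidPDE.SereginSverakTangentialEnergy
import Literature.Analysis.FluidPDE.WeakGradientWeakLimit
import HarnessLib

/-!
# Zooms of a finite-energy profile with finite log-tangential energy converge weakly to zero

Analysis/FluidPDE proof file (theorems only; no definitions, no named facts) on the discharge
path of `Literature.Analysis.FluidPDE.seregin_sverak_2002` (Seregin–Šverák, ARMA 163 (2002), §4).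
Let `b ∈ L²(ℝ³; ℝ³)` be weakly divergence free, with the Morrey bound `∫_{B(x₀,r)} |b|² ≤ M r`
(`0 < r ≤ r₀`) at a point `x₀`, and with **finite log-weighted tangential energy** at `x₀`,
`∫_{B(x₀,1)} |b_τ|²/|x - x₀| < ∞` (`|b_τ|² = |b|² - ⟨x - x₀, b⟩²/|x - x₀|²`). Then the zooms
`b_R(y) = R b(x₀ + R y)` converge weakly to zero as `R → 0⁺`:

* `SereginSverak2002.tendsto_integral_inner_zoom` — for every continuous compactly supported `φ`
  and every sequence `R_j → 0⁺`, `∫ ⟪R_j b(x₀ + R_j y), φ(y)⟫ dy → 0`.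

Mechanism: the zooms are uniformly locally square integrable (Morrey bound at all radii), hence
weakly precompact in the weighted space `L²((1+|y|²)⁻² dy)` (realised inside `L²(dy)` through the
weight `(1+|y|²)⁻¹`; `FunctionSpaces.exists_strictMono_tendsto_inner_of_norm_le`); every weak
limit point `V` is weakly divergence free, and **radial** — the log-tangential energy of `b_R` on
`B(0, a)` equals that of `b` on `B(x₀, aR)`, which tends to `0`, and weighted tangential energies
are weakly lower semicontinuous (duality against one test field); by
`SereginSverak2002.ae_eq_zero_of_isWeaklyDivFree_of_radial` (`RadialSolenoidalVanishing.lean`)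
`V = 0`.

## References

* G. Seregin, V. Šverák, Arch. Ration. Mech. Anal. 163 (2002), 65–86, §4. [SereginSverak2002]
-/

noncomputable section

open MeasureTheory TopologicalSpace Set Function Filter Topology Metric InnerProductSpace
open scoped ENNReal NNReal RealInnerProductSpace ContDiff

namespace Literature.Analysis.FluidPDE

namespace SereginSverak2002

/-! ### Change of variables under the zoom `y ↦ x₀ + R y` -/

section Zoom

variable {b : EuclideanSpace ℝ (Fin 3) → EuclideanSpace ℝ (Fin 3)} {x₀ : EuclideanSpace ℝ (Fin 3)}

/-- `∫ g(x₀ + R y) dy = R⁻³ ∫ g`. [folklore] -/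
theorem integral_comp_zoom (g : EuclideanSpace ℝ (Fin 3) → ℝ) (x₀ : EuclideanSpace ℝ (Fin 3))
    {R : ℝ} (hR : 0 < R) : ∫ y, g (x₀ + R • y) = (R ^ 3)⁻¹ * ∫ x, g x := by
  rw [integral_comp_affine_fin3 g x₀ hR, ← mul_assoc, inv_mul_cancel₀ (by positivity), one_mul]

/-- The zoom maps `B(0, r)` onto `B(x₀, rR)`: indicators. [folklore] -/
theorem indicator_ball_comp_zoom (g : EuclideanSpace ℝ (Fin 3) → ℝ) (x₀ : EuclideanSpace ℝ (Fin 3))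
    {R : ℝ} (hR : 0 < R) (r : ℝ) (y : EuclideanSpace ℝ (Fin 3)) :
    (ball x₀ (r * R)).indicator g (x₀ + R • y) =
      (ball (0 : EuclideanSpace ℝ (Fin 3)) r).indicator (fun y => g (x₀ + R • y)) y := by
  have hiff : x₀ + R • y ∈ ball x₀ (r * R) ↔ y ∈ ball (0 : EuclideanSpace ℝ (Fin 3)) r := by
    rw [mem_ball, mem_ball_zero_iff, dist_eq_norm, add_sub_cancel_left, norm_smul, Real.norm_eq_abs,
      abs_of_pos hR, mul_comm]
    exact mul_lt_mul_iff_of_pos_right hR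
  by_cases hy : y ∈ ball (0 : EuclideanSpace ℝ (Fin 3)) r
  · rw [indicator_of_mem hy, indicator_of_mem (hiff.2 hy)]
  · rw [indicator_of_notMem hy, indicator_of_notMem (fun h => hy (hiff.1 h))]

/-- Set integrals over balls under the zoom: `∫_{B(0,r)} g(x₀ + R y) dy = R⁻³ ∫_{B(x₀, rR)} g`. [folklore] -/
theorem setIntegral_ball_comp_zoom (g : EuclideanSpace ℝ (Fin 3) → ℝ) (x₀ : EuclideanSpace ℝ (Fin 3))
    {R : ℝ} (hR : 0 < R) (r : ℝ) :
    ∫ y in ball (0 : EuclideanSpace ℝ (Fin 3)) r, g (x₀ + R • y) =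
      (R ^ 3)⁻¹ * ∫ x in ball x₀ (r * R), g x := by
  rw [← integral_indicator measurableSet_ball, ← integral_indicator measurableSet_ball,
    ← integral_comp_zoom _ x₀ hR]
  refine integral_congr_ae (Eventually.of_forall fun y => ?_)
  exact (indicator_ball_comp_zoom g x₀ hR r y).symm

/-- **Kinetic energy of the zoom on balls**: `∫_{B(0,r)} |R b(x₀ + R y)|² dy = R⁻¹ ∫_{B(x₀, rR)} |b|²`. [folklore] -/
theorem setIntegral_ball_norm_sq_zoom (b : EuclideanSpace ℝ (Fin 3) → EuclideanSpace ℝ (Fin 3))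
    (x₀ : EuclideanSpace ℝ (Fin 3)) {R : ℝ} (hR : 0 < R) (r : ℝ) :
    ∫ y in ball (0 : EuclideanSpace ℝ (Fin 3)) r, ‖R • b (x₀ + R • y)‖ ^ 2 =
      R⁻¹ * ∫ x in ball x₀ (r * R), ‖b x‖ ^ 2 := by
  have h := setIntegral_ball_comp_zoom (fun x => ‖b x‖ ^ 2) x₀ hR r
  have e : ∀ y, ‖R • b (x₀ + R • y)‖ ^ 2 = R ^ 2 * ‖b (x₀ + R • y)‖ ^ 2 := fun y => by
    rw [norm_smul, Real.norm_eq_abs, abs_of_pos hR]; ring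
  simp_rw [e]
  rw [integral_const_mul, h, ← mul_assoc]
  congr 1
  field_simp

/-- **Kinetic energy of the zoom on balls, lower integrals**:
`∫⁻_{B(0,r)} ‖R b(x₀ + R y)‖ₑ² = R⁻¹ ∫⁻_{B(x₀, rR)} ‖b‖ₑ²`. [folklore] -/
theorem lintegral_ball_norm_sq_zoom (b : EuclideanSpace ℝ (Fin 3) → EuclideanSpace ℝ (Fin 3))
    (x₀ : EuclideanSpace ℝ (Fin 3)) {R : ℝ} (hR : 0 < R) (r : ℝ) :
    ∫⁻ y in ball (0 : EuclideanSpace ℝ (Fin 3)) r, ‖R • b (x₀ + R • y)‖ₑ ^ 2 =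
      ENNReal.ofReal R⁻¹ * ∫⁻ x in ball x₀ (r * R), ‖b x‖ₑ ^ 2 := by
  have hcomm : ∀ y : EuclideanSpace ℝ (Fin 3), R • y + x₀ = x₀ + R • y := fun y => add_comm _ _
  have hiff : ∀ y : EuclideanSpace ℝ (Fin 3), x₀ + R • y ∈ ball x₀ (r * R) ↔
      y ∈ ball (0 : EuclideanSpace ℝ (Fin 3)) r := by
    intro y
    rw [mem_ball, mem_ball_zero_iff, dist_eq_norm, add_sub_cancel_left, norm_smul, Real.norm_eq_abs,
      abs_of_pos hR, mul_comm]
    exact mul_lt_mul_iff_of_pos_right hR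
  have hL : ∫⁻ y in ball (0 : EuclideanSpace ℝ (Fin 3)) r, ‖R • b (x₀ + R • y)‖ₑ ^ 2 =
      ∫⁻ y, ENNReal.ofReal (R ^ 2) *
        (ball x₀ (r * R)).indicator (fun x => ‖b x‖ₑ ^ 2) (x₀ + R • y) := by
    rw [← lintegral_indicator measurableSet_ball]
    refine lintegral_congr fun y => ?_
    by_cases hy : y ∈ ball (0 : EuclideanSpace ℝ (Fin 3)) r
    · rw [indicator_of_mem hy, indicator_of_mem ((hiff y).2 hy), enorm_smul, mul_pow, ← ofReal_norm,
        Real.norm_eq_abs, abs_of_pos hR, ENNReal.ofReal_pow hR.le]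
    · rw [indicator_of_notMem hy, indicator_of_notMem (fun h => hy ((hiff y).1 h)), mul_zero]
  rw [hL, ← lintegral_indicator measurableSet_ball, lintegral_const_mul' _ _ ENNReal.ofReal_ne_top]
  have h := PoincareBall.lintegral_comp_smul_add
    (fun x => (ball x₀ (r * R)).indicator (fun x => ‖b x‖ₑ ^ 2) x) hR.ne' x₀
  rw [finrank_euclideanSpace_fin] at h
  simp_rw [hcomm] at h
  rw [h, ← mul_assoc, ← ENNReal.ofReal_mul (by positivity), abs_of_pos (by positivity)]
  congr 1
  congr 1
  field_simp

/-- **The log-tangential energy is zoom invariant**: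
`∫_{B(0,a)} |(b_R)_τ|²/|y| dy = ∫_{B(x₀, aR)} |b_τ|²/|x - x₀| dx` (lower integrals). [folklore] -/
theorem lintegral_ball_tangential_zoom (b : EuclideanSpace ℝ (Fin 3) → EuclideanSpace ℝ (Fin 3))
    (x₀ : EuclideanSpace ℝ (Fin 3)) {R : ℝ} (hR : 0 < R) (a : ℝ) :
    ∫⁻ y in ball (0 : EuclideanSpace ℝ (Fin 3)) a, ENNReal.ofReal
        ((‖R • b (x₀ + R • y)‖ ^ 2 - ⟪y, R • b (x₀ + R • y)⟫ ^ 2 / ‖y‖ ^ 2) / ‖y‖) =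
      ∫⁻ x in ball x₀ (a * R), ENNReal.ofReal
        ((‖b x‖ ^ 2 - ⟪x - x₀, b x⟫ ^ 2 / ‖x - x₀‖ ^ 2) / ‖x - x₀‖) := by
  -- pointwise: the integrand of the zoom at `y` is `R³ ×` the integrand of `b` at `x₀ + R y`
  set g : EuclideanSpace ℝ (Fin 3) → ℝ := fun x =>
    (‖b x‖ ^ 2 - ⟪x - x₀, b x⟫ ^ 2 / ‖x - x₀‖ ^ 2) / ‖x - x₀‖ with hg
  have hpt : ∀ y, (‖R • b (x₀ + R • y)‖ ^ 2 - ⟪y, R • b (x₀ + R • y)⟫ ^ 2 / ‖y‖ ^ 2) / ‖y‖ =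
      R ^ 3 * g (x₀ + R • y) := by
    intro y
    simp only [hg, add_sub_cancel_left, norm_smul, Real.norm_eq_abs, abs_of_pos hR, inner_smul_left,
      inner_smul_right, RCLike.conj_to_real]
    by_cases hy : y = 0
    · simp [hy]
    · have hy' : 0 < ‖y‖ := norm_pos_iff.2 hy
      field_simp
  -- change variables in the lower integral, through indicators of the balls
  have hcomm : ∀ y : EuclideanSpace ℝ (Fin 3), R • y + x₀ = x₀ + R • y := fun y => add_comm _ _
  have hiff : ∀ y : EuclideanSpace ℝ (Fin 3), x₀ + R • y ∈ ball x₀ (a * R) ↔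
      y ∈ ball (0 : EuclideanSpace ℝ (Fin 3)) a := by
    intro y
    rw [mem_ball, mem_ball_zero_iff, dist_eq_norm, add_sub_cancel_left, norm_smul, Real.norm_eq_abs,
      abs_of_pos hR, mul_comm]
    exact mul_lt_mul_iff_of_pos_right hR
  have hL : ∫⁻ y in ball (0 : EuclideanSpace ℝ (Fin 3)) a, ENNReal.ofReal
      ((‖R • b (x₀ + R • y)‖ ^ 2 - ⟪y, R • b (x₀ + R • y)⟫ ^ 2 / ‖y‖ ^ 2) / ‖y‖) =
      ∫⁻ y, ENNReal.ofReal (R ^ 3) *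
        (ball x₀ (a * R)).indicator (fun x => ENNReal.ofReal (g x)) (x₀ + R • y) := by
    rw [← lintegral_indicator measurableSet_ball]
    refine lintegral_congr fun y => ?_
    by_cases hy : y ∈ ball (0 : EuclideanSpace ℝ (Fin 3)) a
    · rw [indicator_of_mem hy, indicator_of_mem ((hiff y).2 hy), hpt y, ENNReal.ofReal_mul (by positivity)]
    · rw [indicator_of_notMem hy, indicator_of_notMem (fun h => hy ((hiff y).1 h)), mul_zero]
  rw [hL, ← lintegral_indicator measurableSet_ball, lintegral_const_mul' _ _ ENNReal.ofReal_ne_top]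
  have h := PoincareBall.lintegral_comp_smul_add
    (fun x => (ball x₀ (a * R)).indicator (fun x => ENNReal.ofReal (g x)) x) hR.ne' x₀
  rw [finrank_euclideanSpace_fin] at h
  simp_rw [hcomm] at h
  rw [h, ← mul_assoc, ← ENNReal.ofReal_mul (by positivity), abs_of_pos (by positivity),
    mul_inv_cancel₀ (by positivity), ENNReal.ofReal_one, one_mul]

/-- Zooms of an a.e.-strongly measurable field are a.e.-strongly measurable. [folklore] -/
theorem aestronglyMeasurable_zoom (hbm : AEStronglyMeasurable b volume) (x₀ : EuclideanSpace ℝ (Fin 3))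
    {R : ℝ} (hR : 0 < R) :
    AEStronglyMeasurable (fun y => R • b (x₀ + R • y)) volume := by
  -- the zoom is quasi measure preserving (cf. `quasiMeasurePreserving_add_smul` in the tree)
  have hq : Measure.QuasiMeasurePreserving (fun y : EuclideanSpace ℝ (Fin 3) => x₀ + R • y) volume volume :=
    ((measurePreserving_add_left volume x₀).quasiMeasurePreserving).comp
      (Measure.quasiMeasurePreserving_smul volume hR.ne')
  exact (hbm.comp_quasiMeasurePreserving hq).const_smul R

/-- **Uniform local energy of the zooms at all radii** from the Morrey bound at small radii and
the total energy: `∫_{B(0,r)} |b_R|² ≤ max(M, ‖b‖₂²/r₀) r` for `0 < R ≤ 1`. [folklore] -/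
theorem setIntegral_ball_norm_sq_zoom_le (hb2 : Integrable (fun x => ‖b x‖ ^ 2))
    {M r₀ : ℝ} (hr₀ : 0 < r₀)
    (hMorrey : ∀ r, 0 < r → r ≤ r₀ → ∫ x in ball x₀ r, ‖b x‖ ^ 2 ≤ M * r)
    {R : ℝ} (hR : 0 < R) {r : ℝ} (hr : 0 < r) :
    ∫ y in ball (0 : EuclideanSpace ℝ (Fin 3)) r, ‖R • b (x₀ + R • y)‖ ^ 2 ≤
      max M ((∫ x, ‖b x‖ ^ 2) / r₀) * r := by
  rw [setIntegral_ball_norm_sq_zoom b x₀ hR r]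
  by_cases hsmall : r * R ≤ r₀
  · calc R⁻¹ * ∫ x in ball x₀ (r * R), ‖b x‖ ^ 2 ≤ R⁻¹ * (M * (r * R)) :=
          mul_le_mul_of_nonneg_left (hMorrey _ (by positivity) hsmall) (by positivity)
      _ = M * r := by field_simp
      _ ≤ max M ((∫ x, ‖b x‖ ^ 2) / r₀) * r := by gcongr; exact le_max_left _ _
  · push Not at hsmall
    have hE : ∫ x in ball x₀ (r * R), ‖b x‖ ^ 2 ≤ ∫ x, ‖b x‖ ^ 2 :=
      setIntegral_le_integral hb2 (Eventually.of_forall fun x => sq_nonneg _)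
    have hE0 : 0 ≤ ∫ x, ‖b x‖ ^ 2 := integral_nonneg fun x => sq_nonneg _
    have hRinv : R⁻¹ ≤ r / r₀ := by
      rw [inv_le_iff_one_le_mul₀ hR, div_mul_eq_mul_div, le_div_iff₀ hr₀]
      linarith
    calc R⁻¹ * ∫ x in ball x₀ (r * R), ‖b x‖ ^ 2 ≤ (r / r₀) * ∫ x, ‖b x‖ ^ 2 :=
          mul_le_mul hRinv hE (integral_nonneg fun x => sq_nonneg _) (by positivity)
      _ = (∫ x, ‖b x‖ ^ 2) / r₀ * r := by ring
      _ ≤ max M ((∫ x, ‖b x‖ ^ 2) / r₀) * r := by gcongr; exact le_max_right _ _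

end Zoom

/-! ### The weighted energy of a uniformly locally square integrable field -/

section Weight

/-- **Weighted energy bound.** If `∫_{B(0,r)} |V|² ≤ M' r` for all `r > 0` (lower integrals)
then `∫ (1+|y|²)⁻² |V|² ≤ 4 M'` (dyadic shells). [folklore] -/
theorem lintegral_weight_norm_sq_le {V : EuclideanSpace ℝ (Fin 3) → EuclideanSpace ℝ (Fin 3)}
    {M' : ℝ} (hM' : 0 ≤ M')
    (hball : ∀ r, 0 < r → ∫⁻ y in ball (0 : EuclideanSpace ℝ (Fin 3)) r, ‖V y‖ₑ ^ 2 ≤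
      ENNReal.ofReal (M' * r)) :
    ∫⁻ y, ‖((1 + ‖y‖ ^ 2)⁻¹ : ℝ) • V y‖ₑ ^ 2 ≤ ENNReal.ofReal (4 * M') := by
  -- the weighted integrand
  set F : EuclideanSpace ℝ (Fin 3) → ℝ≥0∞ := fun y => ‖((1 + ‖y‖ ^ 2)⁻¹ : ℝ) • V y‖ₑ ^ 2 with hF
  have hFle : ∀ y, ∀ c : ℝ, 0 ≤ c → (1 + ‖y‖ ^ 2)⁻¹ ≤ c → F y ≤ ENNReal.ofReal (c ^ 2) * ‖V y‖ₑ ^ 2 := by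
    intro y c hc hle
    simp only [hF]
    rw [enorm_smul, mul_pow, ← ofReal_norm, Real.norm_eq_abs, abs_of_nonneg (by positivity),
      ← ENNReal.ofReal_pow (by positivity)]
    gcongr
  -- dyadic shells
  set S : ℕ → Set (EuclideanSpace ℝ (Fin 3)) := fun k => {y | (2 : ℝ) ^ k ≤ ‖y‖ ∧ ‖y‖ < 2 ^ (k + 1)}
    with hS
  have hcover : (univ : Set (EuclideanSpace ℝ (Fin 3))) ⊆
      ball (0 : EuclideanSpace ℝ (Fin 3)) 1 ∪ ⋃ k, S k := by
    intro y _
    by_cases hy : ‖y‖ < 1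
    · exact Or.inl (mem_ball_zero_iff.2 hy)
    · push Not at hy
      obtain ⟨k, hk1, hk2⟩ := exists_nat_pow_near hy one_lt_two
      exact Or.inr (mem_iUnion.2 ⟨k, hk1, hk2⟩)
  have h1 : ∫⁻ y in ball (0 : EuclideanSpace ℝ (Fin 3)) 1, F y ≤ ENNReal.ofReal M' := by
    calc ∫⁻ y in ball (0 : EuclideanSpace ℝ (Fin 3)) 1, F y
        ≤ ∫⁻ y in ball (0 : EuclideanSpace ℝ (Fin 3)) 1, ENNReal.ofReal (1 ^ 2) * ‖V y‖ₑ ^ 2 :=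
          lintegral_mono fun y => hFle y 1 zero_le_one (inv_le_one_of_one_le₀ (by nlinarith [norm_nonneg y]))
      _ = ∫⁻ y in ball (0 : EuclideanSpace ℝ (Fin 3)) 1, ‖V y‖ₑ ^ 2 := by simp
      _ ≤ ENNReal.ofReal (M' * 1) := hball 1 one_pos
      _ = ENNReal.ofReal M' := by rw [mul_one]
  have hSm : ∀ k, MeasurableSet (S k) := fun k =>
    (isClosed_le continuous_const continuous_norm).measurableSet.inter
      (isOpen_lt continuous_norm continuous_const).measurableSet
  have hshell : ∀ k : ℕ, ∫⁻ y in S k, F y ≤ ENNReal.ofReal (2 * M' * (1 / 8) ^ k) := by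
    intro k
    have h2k : (0 : ℝ) < 2 ^ k := by positivity
    set c : ℝ := (((2 : ℝ) ^ k) ^ 2)⁻¹ with hc
    have hc0 : 0 ≤ c := by positivity
    have hw : ∀ y ∈ S k, (1 + ‖y‖ ^ 2)⁻¹ ≤ c := by
      intro y hy
      have h1 : (2 : ℝ) ^ k ≤ ‖y‖ := hy.1
      simp only [hc]
      apply inv_anti₀ (by positivity)
      nlinarith [pow_le_pow_left₀ h2k.le h1 2]
    have hsub : S k ⊆ ball (0 : EuclideanSpace ℝ (Fin 3)) (2 ^ (k + 1)) := fun y hy =>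
      mem_ball_zero_iff.2 hy.2
    calc ∫⁻ y in S k, F y ≤ ∫⁻ y in S k, ENNReal.ofReal (c ^ 2) * ‖V y‖ₑ ^ 2 :=
          setLIntegral_mono' (hSm k) fun y hy => hFle y c hc0 (hw y hy)
      _ = ENNReal.ofReal (c ^ 2) * ∫⁻ y in S k, ‖V y‖ₑ ^ 2 := by
          rw [lintegral_const_mul' _ _ ENNReal.ofReal_ne_top]
      _ ≤ ENNReal.ofReal (c ^ 2) * ∫⁻ y in ball (0 : EuclideanSpace ℝ (Fin 3)) (2 ^ (k + 1)), ‖V y‖ₑ ^ 2 :=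
          mul_le_mul_right (lintegral_mono_set hsub) _
      _ ≤ ENNReal.ofReal (c ^ 2) * ENNReal.ofReal (M' * 2 ^ (k + 1)) := by
          gcongr; exact hball _ (by positivity)
      _ = ENNReal.ofReal (2 * M' * (1 / 8) ^ k) := by
          rw [← ENNReal.ofReal_mul (by positivity)]
          congr 1
          simp only [hc]
          have h8 : (1 / 8 : ℝ) ^ k = (((2 : ℝ) ^ k) ^ 3)⁻¹ := by
            rw [one_div, inv_pow]
            congr 1
            rw [show (8 : ℝ) = 2 ^ 3 by norm_num, ← pow_mul, ← pow_mul, mul_comm]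
          rw [h8, pow_succ]
          field_simp
          ring
  calc ∫⁻ y, F y = ∫⁻ y in univ, F y := (setLIntegral_univ _).symm
    _ ≤ ∫⁻ y in ball (0 : EuclideanSpace ℝ (Fin 3)) 1 ∪ ⋃ k, S k, F y := lintegral_mono_set hcover
    _ ≤ (∫⁻ y in ball (0 : EuclideanSpace ℝ (Fin 3)) 1, F y) + ∫⁻ y in ⋃ k, S k, F y :=
        lintegral_union_le _ _ _
    _ ≤ ENNReal.ofReal M' + ∑' k, ∫⁻ y in S k, F y := add_le_add h1 (lintegral_iUnion_le _ _)
    _ ≤ ENNReal.ofReal M' + ∑' k : ℕ, ENNReal.ofReal (2 * M' * (1 / 8) ^ k) := by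
        gcongr; exact hshell _
    _ = ENNReal.ofReal M' + ENNReal.ofReal (2 * M') * ∑' k : ℕ, ENNReal.ofReal (1 / 8) ^ k := by
        congr 1
        rw [← ENNReal.tsum_mul_left]
        refine tsum_congr fun k => ?_
        rw [ENNReal.ofReal_mul (by positivity), ENNReal.ofReal_pow (by norm_num)]
    _ = ENNReal.ofReal M' + ENNReal.ofReal (2 * M') * (1 - ENNReal.ofReal (1 / 8))⁻¹ := by
        rw [ENNReal.tsum_geometric]
    _ ≤ ENNReal.ofReal M' + ENNReal.ofReal (2 * M') * ENNReal.ofReal (3 / 2) := by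
        gcongr
        rw [← ENNReal.ofReal_one, ← ENNReal.ofReal_sub _ (by norm_num : (0 : ℝ) ≤ 1 / 8),
          ← ENNReal.ofReal_inv_of_pos (by norm_num)]
        exact ENNReal.ofReal_le_ofReal (by norm_num)
    _ = ENNReal.ofReal (4 * M') := by
        rw [← ENNReal.ofReal_mul (by positivity), ← ENNReal.ofReal_add hM' (by positivity)]
        congr 1; ring

end Weight

/-! ### Pairings of weighted `L²` classes with compactly supported fields -/

section Pairing

/-- A square-integrable field supported in a ball stays square integrable after multiplication
by the (locally bounded) inverse weight `1 + |y|²`. [folklore] -/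
theorem memLp_two_weightInv_smul {ζ : EuclideanSpace ℝ (Fin 3) → EuclideanSpace ℝ (Fin 3)}
    (hζ : MemLp ζ 2) {ρ : ℝ} (hsupp : ∀ y, y ∉ ball (0 : EuclideanSpace ℝ (Fin 3)) ρ → ζ y = 0) :
    MemLp (fun y => ((1 + ‖y‖ ^ 2) : ℝ) • ζ y) 2 := by
  refine MemLp.of_le_mul (c := 1 + ρ ^ 2) hζ
    ((continuous_const.add (continuous_norm.pow 2)).aestronglyMeasurable.smul hζ.aestronglyMeasurable)
    (Eventually.of_forall fun y => ?_)
  by_cases hy : y ∈ ball (0 : EuclideanSpace ℝ (Fin 3)) ρ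
  · rw [norm_smul, Real.norm_eq_abs, abs_of_nonneg (by positivity)]
    refine mul_le_mul_of_nonneg_right ?_ (norm_nonneg _)
    have : ‖y‖ < ρ := mem_ball_zero_iff.1 hy
    nlinarith [norm_nonneg y]
  · rw [hsupp y hy]; simp

/-- **Weighted pairing.** `∫ ⟪(1+|y|²)⁻¹ V, (1+|y|²) ζ⟫ = ∫ ⟪V, ζ⟫`. [folklore] -/
theorem integral_inner_weight_smul_weightInv_smul
    (V ζ : EuclideanSpace ℝ (Fin 3) → EuclideanSpace ℝ (Fin 3)) :
    ∫ y, ⟪((1 + ‖y‖ ^ 2)⁻¹ : ℝ) • V y, ((1 + ‖y‖ ^ 2) : ℝ) • ζ y⟫ = ∫ y, ⟪V y, ζ y⟫ := by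
  refine integral_congr_ae (Eventually.of_forall fun y => ?_)
  have h : (0 : ℝ) < 1 + ‖y‖ ^ 2 := by positivity
  show ⟪((1 + ‖y‖ ^ 2)⁻¹ : ℝ) • V y, ((1 + ‖y‖ ^ 2) : ℝ) • ζ y⟫ = ⟪V y, ζ y⟫
  rw [real_inner_smul_left, real_inner_smul_right, ← mul_assoc, inv_mul_cancel₀ h.ne', one_mul]

end Pairing

/-! ### Zooms of a weakly divergence-free field are weakly divergence free -/

section DivFree

variable {b : EuclideanSpace ℝ (Fin 3) → EuclideanSpace ℝ (Fin 3)} {x₀ : EuclideanSpace ℝ (Fin 3)}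

/-- The gradient of `x ↦ θ(R⁻¹(x - x₀))` is `R⁻¹ (∇θ)(R⁻¹(x - x₀))`. [folklore] -/
theorem gradient_comp_zoomInv {θ : EuclideanSpace ℝ (Fin 3) → ℝ} (hθ : ContDiff ℝ ∞ θ)
    (x₀ : EuclideanSpace ℝ (Fin 3)) (R : ℝ) (x : EuclideanSpace ℝ (Fin 3)) :
    gradient (fun x => θ (R⁻¹ • (x - x₀))) x = R⁻¹ • gradient θ (R⁻¹ • (x - x₀)) := by
  have hd : DifferentiableAt ℝ θ (R⁻¹ • (x - x₀)) := (hθ.differentiable (by simp)).differentiableAt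
  have hA : HasFDerivAt (fun x : EuclideanSpace ℝ (Fin 3) => R⁻¹ • (x - x₀))
      (R⁻¹ • ContinuousLinearMap.id ℝ (EuclideanSpace ℝ (Fin 3))) x := by
    have h1 : HasFDerivAt (fun x : EuclideanSpace ℝ (Fin 3) => x - x₀)
        (ContinuousLinearMap.id ℝ (EuclideanSpace ℝ (Fin 3))) x := (hasFDerivAt_id x).sub_const x₀
    exact h1.const_smul R⁻¹
  have hcomp : HasFDerivAt (fun x : EuclideanSpace ℝ (Fin 3) => θ (R⁻¹ • (x - x₀)))
      ((fderiv ℝ θ (R⁻¹ • (x - x₀))).comp (R⁻¹ • ContinuousLinearMap.id ℝ (EuclideanSpace ℝ (Fin 3)))) x :=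
    hd.hasFDerivAt.comp x hA
  apply ext_inner_right ℝ
  intro v
  rw [gradient, InnerProductSpace.toDual_symm_apply, hcomp.fderiv, ContinuousLinearMap.comp_apply,
    FunLike.coe_smul, Pi.smul_apply, ContinuousLinearMap.id_apply, ContinuousLinearMap.map_smul,
    smul_eq_mul, real_inner_smul_left, gradient, InnerProductSpace.toDual_symm_apply]

/-- **Zooms of a weakly divergence-free field are weakly divergence free.** [folklore] -/
theorem isWeaklyDivFree_zoom (hdiv : IsWeaklyDivFree b)
    (x₀ : EuclideanSpace ℝ (Fin 3)) {R : ℝ} (hR : 0 < R) :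
    IsWeaklyDivFree fun y => R • b (x₀ + R • y) := by
  intro θ hθ
  -- the zoomed-out test function
  set θR : EuclideanSpace ℝ (Fin 3) → ℝ := fun x => θ (R⁻¹ • (x - x₀)) with hθR
  have hθRs : ContDiff ℝ ∞ θR := hθ.contDiff.comp ((contDiff_id.sub contDiff_const).const_smul R⁻¹)
  have hθRc : HasCompactSupport θR := by
    -- `θR = θ ∘ (homeomorphism)`
    set e : EuclideanSpace ℝ (Fin 3) ≃ₜ EuclideanSpace ℝ (Fin 3) :=
      (Homeomorph.addRight (-x₀)).trans (Homeomorph.smulOfNeZero R⁻¹ (inv_ne_zero hR.ne')) with he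
    have : θR = θ ∘ e := by
      funext x
      simp [hθR, he, Homeomorph.trans, sub_eq_add_neg]
    rw [this]
    exact hθ.hasCompactSupport.comp_homeomorph e
  have hθRtest : FunctionSpaces.IsTestFunctionOn (⊤ : Opens (EuclideanSpace ℝ (Fin 3))) θR :=
    ⟨hθRs, hθRc, fun _ _ => trivial⟩
  have h0 := hdiv θR hθRtest
  -- `∇θ(y) = R ∇θR(x₀ + R y)`
  have hgrad : ∀ y, gradient θ y = R • gradient θR (x₀ + R • y) := by
    intro y
    rw [hθR, gradient_comp_zoomInv hθ.contDiff x₀ R, smul_smul, mul_inv_cancel₀ hR.ne', one_smul,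
      add_sub_cancel_left, smul_smul, inv_mul_cancel₀ hR.ne', one_smul]
  -- change variables
  have e1 : ∫ y, ⟪R • b (x₀ + R • y), gradient θ y⟫ =
      R ^ 2 * ∫ y, (fun x => ⟪b x, gradient θR x⟫) (x₀ + R • y) := by
    rw [← integral_const_mul]
    refine integral_congr_ae (Eventually.of_forall fun y => ?_)
    show ⟪R • b (x₀ + R • y), gradient θ y⟫ = R ^ 2 * ⟪b (x₀ + R • y), gradient θR (x₀ + R • y)⟫
    rw [hgrad y, inner_smul_left, inner_smul_right, RCLike.conj_to_real]
    ring
  rw [e1, integral_comp_zoom (fun x => ⟪b x, gradient θR x⟫) x₀ hR, h0, mul_zero, mul_zero]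

end DivFree

/-! ### Weak limits of the zooms -/

section WeakLimit

/-- **Pairings pass to weak limits taken in the weighted space.** If the weighted classes
`(1+|y|²)⁻¹ V_k ⇀ (1+|y|²)⁻¹ V` weakly in `L²(dy)`, then `∫ ⟪V_k, ζ⟫ → ∫ ⟪V, ζ⟫` for every
`ζ ∈ L²` supported in a ball. [folklore] -/
theorem tendsto_integral_inner_of_weak
    {V : ℕ → EuclideanSpace ℝ (Fin 3) → EuclideanSpace ℝ (Fin 3)}
    {Vl : EuclideanSpace ℝ (Fin 3) → EuclideanSpace ℝ (Fin 3)}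
    (hW : ∀ k, MemLp (fun y => ((1 + ‖y‖ ^ 2)⁻¹ : ℝ) • V k y) 2)
    (hWl : MemLp (fun y => ((1 + ‖y‖ ^ 2)⁻¹ : ℝ) • Vl y) 2)
    (hweak : ∀ z : Lp (EuclideanSpace ℝ (Fin 3)) 2 (volume : Measure (EuclideanSpace ℝ (Fin 3))),
      Tendsto (fun k => ⟪(hW k).toLp _, z⟫) atTop (𝓝 ⟪hWl.toLp _, z⟫))
    {ζ : EuclideanSpace ℝ (Fin 3) → EuclideanSpace ℝ (Fin 3)} (hζ : MemLp ζ 2) {ρ : ℝ}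
    (hsupp : ∀ y, y ∉ ball (0 : EuclideanSpace ℝ (Fin 3)) ρ → ζ y = 0) :
    Tendsto (fun k => ∫ y, ⟪V k y, ζ y⟫) atTop (𝓝 (∫ y, ⟪Vl y, ζ y⟫)) := by
  have hζ' := memLp_two_weightInv_smul hζ hsupp
  have h := hweak (hζ'.toLp _)
  have e1 : ∀ k, ⟪(hW k).toLp _, hζ'.toLp _⟫ = ∫ y, ⟪V k y, ζ y⟫ := fun k => by
    rw [WeakGradientLimit.inner_toLp_toLp_eq_integral, integral_inner_weight_smul_weightInv_smul]
  have e2 : ⟪hWl.toLp _, hζ'.toLp _⟫ = ∫ y, ⟪Vl y, ζ y⟫ := by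
    rw [WeakGradientLimit.inner_toLp_toLp_eq_integral, integral_inner_weight_smul_weightInv_smul]
  simp_rw [e1, e2] at h
  exact h

/-- From `τ(v) = 0` to radiality: `|y|² v = ⟨v, y⟩ y`. [folklore] -/
theorem radial_of_tangential_eq_zero {v y : EuclideanSpace ℝ (Fin 3)} (hy : y ≠ 0)
    (h : ‖v‖ ^ 2 - ⟪y, v⟫ ^ 2 / ‖y‖ ^ 2 = 0) : (‖y‖ ^ 2) • v = ⟪v, y⟫ • y := by
  have hy2 : 0 < ‖y‖ ^ 2 := by positivity
  have h1 : ‖y‖ ^ 2 * ‖v‖ ^ 2 = ⟪y, v⟫ ^ 2 := by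
    field_simp at h
    linarith
  have h2 : ‖(‖y‖ ^ 2) • v - ⟪v, y⟫ • y‖ ^ 2 = 0 := by
    rw [norm_sub_sq_real, norm_smul, norm_smul, real_inner_smul_left, real_inner_smul_right,
      Real.norm_eq_abs, Real.norm_eq_abs, abs_of_nonneg hy2.le]
    simp only [real_inner_comm v y] at h1 ⊢
    have ha := sq_abs ⟪v, y⟫
    have hb := sq_abs ⟪y, v⟫
    nlinarith [ha, hb, h1]
  rw [← sub_eq_zero]
  exact norm_eq_zero.1 (pow_eq_zero_iff two_ne_zero |>.1 h2)

/-- The tangential projection `v - (⟨y, v⟩/|y|²) y` has norm at most `2|v|`. [folklore] -/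
theorem norm_tangentialProj_le (v y : EuclideanSpace ℝ (Fin 3)) :
    ‖v - (⟪y, v⟫ / ‖y‖ ^ 2) • y‖ ≤ 2 * ‖v‖ := by
  by_cases hy : y = 0
  · have e : ‖v - (⟪y, v⟫ / ‖y‖ ^ 2) • y‖ = ‖v‖ := by rw [hy]; simp
    rw [e]; linarith [norm_nonneg v]
  · have hρ : 0 < ‖y‖ := norm_pos_iff.2 hy
    calc ‖v - (⟪y, v⟫ / ‖y‖ ^ 2) • y‖ ≤ ‖v‖ + ‖(⟪y, v⟫ / ‖y‖ ^ 2) • y‖ := norm_sub_le _ _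
      _ = ‖v‖ + |⟪y, v⟫| / ‖y‖ := by
          rw [norm_smul, Real.norm_eq_abs, abs_div, abs_of_nonneg (sq_nonneg ‖y‖)]
          field_simp
      _ ≤ ‖v‖ + ‖y‖ * ‖v‖ / ‖y‖ := by gcongr; exact abs_real_inner_le_norm _ _
      _ = 2 * ‖v‖ := by field_simp; ring

/-- Pairing with the weighted tangential projection:
`⟪v, c • (u - (⟨y, u⟩/|y|²) • y)⟫ = c (⟨v, u⟩ - ⟨y, v⟩⟨y, u⟩/|y|²)`. [folklore] -/
theorem inner_smul_tangentialProj (v u y : EuclideanSpace ℝ (Fin 3)) (c : ℝ) :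
    ⟪v, c • (u - (⟪y, u⟫ / ‖y‖ ^ 2) • y)⟫ = c * (⟪v, u⟫ - ⟪y, v⟫ * ⟪y, u⟫ / ‖y‖ ^ 2) := by
  rw [real_inner_smul_right, inner_sub_right, real_inner_smul_right]
  have hc : ⟪v, y⟫ = ⟪y, v⟫ := real_inner_comm y v
  rw [hc]
  ring

set_option maxHeartbeats 1600000 in
/-- **Extraction.** Under the hypotheses of the file (see the module docstring), every sequence
of zooms `b_{R_j}`, `R_j → 0⁺`, has a subsequence along which `∫ ⟪b_{R_j}, φ⟫ → 0` for the
given compactly supported square-integrable field `φ`. [cite: SereginSverak2002, §4] -/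
theorem exists_subseq_tendsto_integral_inner_zoom
    {b : EuclideanSpace ℝ (Fin 3) → EuclideanSpace ℝ (Fin 3)} (hb2 : MemLp b 2)
    (hdiv : IsWeaklyDivFree b) (x₀ : EuclideanSpace ℝ (Fin 3)) {M r₀ : ℝ} (hM : 0 ≤ M) (hr₀ : 0 < r₀)
    (hMorrey : ∀ r, 0 < r → r ≤ r₀ → ∫ x in ball x₀ r, ‖b x‖ ^ 2 ≤ M * r)
    (htan : ∫⁻ x in ball x₀ 1, ENNReal.ofReal
      ((‖b x‖ ^ 2 - ⟪x - x₀, b x⟫ ^ 2 / ‖x - x₀‖ ^ 2) / ‖x - x₀‖) ≠ ⊤)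
    {φ : EuclideanSpace ℝ (Fin 3) → EuclideanSpace ℝ (Fin 3)} (hφ : MemLp φ 2) {ρφ : ℝ}
    (hφs : ∀ y, y ∉ ball (0 : EuclideanSpace ℝ (Fin 3)) ρφ → φ y = 0)
    {R : ℕ → ℝ} (hRpos : ∀ j, 0 < R j) (hR0 : Tendsto R atTop (𝓝 0)) :
    ∃ ms : ℕ → ℕ, StrictMono ms ∧
      Tendsto (fun k => ∫ y, ⟪R (ms k) • b (x₀ + R (ms k) • y), φ y⟫) atTop (𝓝 0) := by
  have hbm : AEStronglyMeasurable b volume := hb2.aestronglyMeasurable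
  have hbL2 : Integrable (fun x => ‖b x‖ ^ 2) := hb2.integrable_norm_pow two_ne_zero
  set E0 : ℝ := ∫ x, ‖b x‖ ^ 2 with hE0
  have hE00 : 0 ≤ E0 := integral_nonneg fun x => sq_nonneg _
  set M' : ℝ := max M (E0 / r₀) with hM'
  have hM'0 : 0 ≤ M' := le_max_of_le_left hM
  -- the zooms and their uniform local energy
  set V : ℕ → EuclideanSpace ℝ (Fin 3) → EuclideanSpace ℝ (Fin 3) :=
    fun j y => R j • b (x₀ + R j • y) with hV
  have hVm : ∀ j, AEStronglyMeasurable (V j) volume := fun j => aestronglyMeasurable_zoom hbm x₀ (hRpos j)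
  have hbball : ∀ s : ℝ, ∫⁻ x in ball x₀ s, ‖b x‖ₑ ^ 2 = ENNReal.ofReal (∫ x in ball x₀ s, ‖b x‖ ^ 2) := by
    intro s
    rw [ofReal_integral_eq_lintegral_ofReal hbL2.integrableOn (Eventually.of_forall fun x => sq_nonneg _)]
    refine lintegral_congr fun x => ?_
    rw [← ofReal_norm, ENNReal.ofReal_pow (norm_nonneg _)]
  have hVball : ∀ j, ∀ r, 0 < r → ∫⁻ y in ball (0 : EuclideanSpace ℝ (Fin 3)) r, ‖V j y‖ₑ ^ 2 ≤
      ENNReal.ofReal (M' * r) := by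
    intro j r hr
    simp only [hV]
    rw [lintegral_ball_norm_sq_zoom b x₀ (hRpos j) r, hbball,
      ← ENNReal.ofReal_mul (inv_nonneg.2 (hRpos j).le)]
    refine ENNReal.ofReal_le_ofReal ?_
    have h := setIntegral_ball_norm_sq_zoom_le (x₀ := x₀) hbL2 hr₀ hMorrey (hRpos j) hr
    rw [setIntegral_ball_norm_sq_zoom b x₀ (hRpos j) r] at h
    exact h
  -- the weighted classes
  set W : ℕ → EuclideanSpace ℝ (Fin 3) → EuclideanSpace ℝ (Fin 3) :=
    fun j y => ((1 + ‖y‖ ^ 2)⁻¹ : ℝ) • V j y with hWdef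
  have hwc0 : Continuous fun y : EuclideanSpace ℝ (Fin 3) => ((1 + ‖y‖ ^ 2) : ℝ) := by fun_prop
  have hwc : Continuous fun y : EuclideanSpace ℝ (Fin 3) => ((1 + ‖y‖ ^ 2)⁻¹ : ℝ) :=
    hwc0.inv₀ fun y => (add_pos_of_pos_of_nonneg one_pos (sq_nonneg ‖y‖)).ne'
  have hWm : ∀ j, AEStronglyMeasurable (W j) volume := fun j => hwc.aestronglyMeasurable.smul (hVm j)
  have hWlin : ∀ j, ∫⁻ y, ‖W j y‖ₑ ^ 2 ≤ ENNReal.ofReal (4 * M') := fun j =>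
    lintegral_weight_norm_sq_le hM'0 (hVball j)
  have hWnorm : ∀ j, eLpNorm (W j) 2 volume ≤ ENNReal.ofReal (4 * M') ^ (1 / 2 : ℝ) := by
    intro j
    rw [eLpNorm_eq_lintegral_rpow_enorm_toReal two_ne_zero ENNReal.ofNat_ne_top]
    simp only [ENNReal.toReal_ofNat, ENNReal.rpow_ofNat]
    exact ENNReal.rpow_le_rpow (hWlin j) (by norm_num)
  have hWmem : ∀ j, MemLp (W j) 2 volume := fun j =>
    ⟨hWm j, (hWnorm j).trans_lt (ENNReal.rpow_lt_top_of_nonneg (by norm_num) ENNReal.ofReal_ne_top)⟩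
  set Mw : ℝ := (ENNReal.ofReal (4 * M') ^ (1 / 2 : ℝ)).toReal with hMw
  set w : ℕ → Lp (EuclideanSpace ℝ (Fin 3)) 2 (volume : Measure (EuclideanSpace ℝ (Fin 3))) :=
    fun j => (hWmem j).toLp (W j) with hw
  have hwM : ∀ j, ‖w j‖ ≤ Mw := fun j => by
    rw [hw, Lp.norm_toLp, hMw]
    exact ENNReal.toReal_mono (ENNReal.rpow_ne_top_of_nonneg (by norm_num) ENNReal.ofReal_ne_top) (hWnorm j)
  -- weak limit along a subsequence
  haveI : Fact ((2 : ℝ≥0∞) ≠ (⊤ : ℝ≥0∞)) := ⟨ENNReal.ofNat_ne_top⟩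
  obtain ⟨ms, hms, wl, -, hweak⟩ := FunctionSpaces.exists_strictMono_tendsto_inner_of_norm_le hwM
  have hwlmem : MemLp (wl : EuclideanSpace ℝ (Fin 3) → EuclideanSpace ℝ (Fin 3)) 2 volume := Lp.memLp wl
  set Vl : EuclideanSpace ℝ (Fin 3) → EuclideanSpace ℝ (Fin 3) :=
    fun y => ((1 + ‖y‖ ^ 2) : ℝ) • (wl : EuclideanSpace ℝ (Fin 3) → EuclideanSpace ℝ (Fin 3)) y with hVl
  have hVlW : (fun y => ((1 + ‖y‖ ^ 2)⁻¹ : ℝ) • Vl y) =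
      (wl : EuclideanSpace ℝ (Fin 3) → EuclideanSpace ℝ (Fin 3)) := by
    funext y
    simp only [hVl, smul_smul]
    rw [inv_mul_cancel₀ (by positivity : (1 + ‖y‖ ^ 2 : ℝ) ≠ 0), one_smul]
  have hWlmem : MemLp (fun y => ((1 + ‖y‖ ^ 2)⁻¹ : ℝ) • Vl y) 2 volume := by rw [hVlW]; exact hwlmem
  have hweak' : ∀ z : Lp (EuclideanSpace ℝ (Fin 3)) 2 (volume : Measure (EuclideanSpace ℝ (Fin 3))),
      Tendsto (fun k => ⟪(hWmem (ms k)).toLp _, z⟫) atTop (𝓝 ⟪hWlmem.toLp _, z⟫) := by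
    intro z
    have e : hWlmem.toLp _ = wl := by
      have : hWlmem.toLp (fun y => ((1 + ‖y‖ ^ 2)⁻¹ : ℝ) • Vl y) = hwlmem.toLp _ := by
        congr 1
      rw [this]
      exact Lp.toLp_coeFn wl hwlmem
    rw [e]
    exact hweak z
  have hpair : ∀ {ζ : EuclideanSpace ℝ (Fin 3) → EuclideanSpace ℝ (Fin 3)}, MemLp ζ 2 → ∀ {ρ : ℝ},
      (∀ y, y ∉ ball (0 : EuclideanSpace ℝ (Fin 3)) ρ → ζ y = 0) →
      Tendsto (fun k => ∫ y, ⟪V (ms k) y, ζ y⟫) atTop (𝓝 (∫ y, ⟪Vl y, ζ y⟫)) :=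
    fun hζ ρ hsupp => tendsto_integral_inner_of_weak (V := fun k => V (ms k)) (fun k => hWmem (ms k))
      hWlmem hweak' hζ hsupp
  -- `L²` facts on the limit
  have hVlm : AEStronglyMeasurable Vl volume :=
    (continuous_const.add (continuous_norm.pow 2)).aestronglyMeasurable.smul hwlmem.aestronglyMeasurable
  have hVlbound : ∀ {a : ℝ} (y : EuclideanSpace ℝ (Fin 3)), y ∈ ball (0 : EuclideanSpace ℝ (Fin 3)) a →
      ‖Vl y‖ ≤ (1 + a ^ 2) * ‖(wl : EuclideanSpace ℝ (Fin 3) → EuclideanSpace ℝ (Fin 3)) y‖ := by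
    intro a y hy
    simp only [hVl, norm_smul, Real.norm_eq_abs, abs_of_nonneg (by positivity : (0 : ℝ) ≤ 1 + ‖y‖ ^ 2)]
    refine mul_le_mul_of_nonneg_right ?_ (norm_nonneg _)
    have : ‖y‖ < a := mem_ball_zero_iff.1 hy
    nlinarith [norm_nonneg y]
  have hwlL2 : Integrable fun y => ‖(wl : EuclideanSpace ℝ (Fin 3) → EuclideanSpace ℝ (Fin 3)) y‖ ^ 2 :=
    hwlmem.integrable_norm_pow two_ne_zero
  have hVl2 : ∀ a : ℝ, IntegrableOn (fun y => ‖Vl y‖ ^ 2) (ball (0 : EuclideanSpace ℝ (Fin 3)) a) := by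
    intro a
    refine Integrable.mono' ((hwlL2.const_mul ((1 + a ^ 2) ^ 2)).integrableOn)
      ((hVlm.norm.pow 2).restrict) ?_
    filter_upwards [ae_restrict_mem measurableSet_ball] with y hy
    rw [Real.norm_eq_abs, abs_of_nonneg (sq_nonneg _)]
    calc ‖Vl y‖ ^ 2 ≤ ((1 + a ^ 2) * ‖(wl : EuclideanSpace ℝ (Fin 3) → EuclideanSpace ℝ (Fin 3)) y‖) ^ 2 :=
          pow_le_pow_left₀ (norm_nonneg _) (hVlbound y hy) 2
      _ = (1 + a ^ 2) ^ 2 * ‖(wl : EuclideanSpace ℝ (Fin 3) → EuclideanSpace ℝ (Fin 3)) y‖ ^ 2 := by ring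
  have hVlloc : LocallyIntegrable Vl := by
    refine (locallyIntegrable_iff.2 fun K hK => ?_)
    have hwlK : IntegrableOn (wl : EuclideanSpace ℝ (Fin 3) → EuclideanSpace ℝ (Fin 3)) K :=
      (hwlmem.locallyIntegrable (by norm_num)).integrableOn_isCompact hK
    exact hwlK.continuousOn_smul (continuous_const.add (continuous_norm.pow 2)).continuousOn hK
  -- (1) the limit is weakly divergence free
  have hdivVl : IsWeaklyDivFree Vl := by
    intro θ hθ
    have hgc : Continuous fun y => gradient θ y := by
      have : (fun y => gradient θ y) = (InnerProductSpace.toDual ℝ (EuclideanSpace ℝ (Fin 3))).symm ∘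
          fun y => fderiv ℝ θ y := rfl
      rw [this]
      exact (LinearIsometryEquiv.continuous _).comp (hθ.contDiff.continuous_fderiv (by simp))
    have hgs : HasCompactSupport fun y => gradient θ y := by
      have : (fun y => gradient θ y) = (InnerProductSpace.toDual ℝ (EuclideanSpace ℝ (Fin 3))).symm ∘
          fun y => fderiv ℝ θ y := rfl
      rw [this]
      exact (hθ.hasCompactSupport.fderiv ℝ).comp_left (map_zero _)
    obtain ⟨ρ, hρ⟩ := hgs.isCompact.isBounded.subset_ball (0 : EuclideanSpace ℝ (Fin 3))
    have hζ : MemLp (fun y => gradient θ y) 2 volume := hgc.memLp_of_hasCompactSupport hgs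
    have hsupp : ∀ y, y ∉ ball (0 : EuclideanSpace ℝ (Fin 3)) ρ → gradient θ y = 0 := fun y hy =>
      image_eq_zero_of_notMem_tsupport fun h => hy (hρ h)
    have hlim := hpair hζ hsupp
    have hzero : ∀ k, ∫ y, ⟪V (ms k) y, gradient θ y⟫ = 0 := fun k =>
      isWeaklyDivFree_zoom hdiv x₀ (hRpos (ms k)) θ hθ
    simp_rw [hzero] at hlim
    exact tendsto_nhds_unique hlim tendsto_const_nhds ▸ rfl
  -- (2) the log-tangential energies of the zooms tend to zero
  set τf : EuclideanSpace ℝ (Fin 3) → EuclideanSpace ℝ (Fin 3) → ℝ := fun y v =>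
    ‖v‖ ^ 2 - ⟪y, v⟫ ^ 2 / ‖y‖ ^ 2 with hτf
  have hτnn : ∀ y v, 0 ≤ τf y v := by
    intro y v
    simp only [hτf]
    by_cases hy : y = 0
    · simp [hy]
    · have hy2 : 0 < ‖y‖ ^ 2 := by positivity
      rw [sub_nonneg, div_le_iff₀ hy2]
      have h0 := abs_real_inner_le_norm y v
      calc ⟪y, v⟫ ^ 2 = |⟪y, v⟫| ^ 2 := (sq_abs _).symm
        _ ≤ (‖y‖ * ‖v‖) ^ 2 := pow_le_pow_left₀ (abs_nonneg _) h0 2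
        _ = ‖v‖ ^ 2 * ‖y‖ ^ 2 := by ring
  have hτle : ∀ y v, τf y v ≤ ‖v‖ ^ 2 := fun y v => by
    simp only [hτf]; linarith [div_nonneg (sq_nonneg ⟪y, v⟫) (sq_nonneg ‖y‖)]
  set fb : EuclideanSpace ℝ (Fin 3) → ℝ≥0∞ := fun x =>
    ENNReal.ofReal ((‖b x‖ ^ 2 - ⟪x - x₀, b x⟫ ^ 2 / ‖x - x₀‖ ^ 2) / ‖x - x₀‖) with hfb
  have htend0 : ∀ a : ℝ, 0 < a →
      Tendsto (fun k => ∫⁻ y in ball (0 : EuclideanSpace ℝ (Fin 3)) a,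
        ENNReal.ofReal (τf y (V (ms k) y) / ‖y‖)) atTop (𝓝 0) := by
    intro a ha
    have hRms : Tendsto (fun k => R (ms k)) atTop (𝓝 0) := hR0.comp hms.tendsto_atTop
    -- eventually `a R ≤ 1`, and then the energy is `∫_{B(x₀, aR)} fb` w.r.t. `volume|_{B(x₀,1)}`
    have hev : ∀ᶠ k in atTop, a * R (ms k) ≤ 1 := by
      have : Tendsto (fun k => a * R (ms k)) atTop (𝓝 (a * 0)) := hRms.const_mul a
      rw [mul_zero] at this
      exact (this.eventually (Iic_mem_nhds one_pos)).mono fun k hk => hk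
    set μ1 : Measure (EuclideanSpace ℝ (Fin 3)) := volume.restrict (ball x₀ 1) with hμ1
    have hfin : ∫⁻ x, fb x ∂μ1 ≠ ⊤ := htan
    have hsets : Tendsto (μ1 ∘ fun k => ball x₀ (a * R (ms k))) atTop (𝓝 0) := by
      have hvol : ∀ k, (μ1 ∘ fun k => ball x₀ (a * R (ms k))) k ≤
          ENNReal.ofReal ((a * R (ms k)) ^ 3) * volume (ball (0 : EuclideanSpace ℝ (Fin 3)) 1) := by
        intro k
        simp only [Function.comp, hμ1]
        calc volume.restrict (ball x₀ 1) (ball x₀ (a * R (ms k))) ≤ volume (ball x₀ (a * R (ms k))) :=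
              Measure.restrict_apply_le _ _
          _ = ENNReal.ofReal ((a * R (ms k)) ^ 3) * volume (ball (0 : EuclideanSpace ℝ (Fin 3)) 1) := by
              rw [Measure.addHaar_ball volume x₀ (by have := hRpos (ms k); positivity),
                finrank_euclideanSpace_fin]
      have hlim : Tendsto (fun k => ENNReal.ofReal ((a * R (ms k)) ^ 3) *
          volume (ball (0 : EuclideanSpace ℝ (Fin 3)) 1)) atTop (𝓝 0) := by
        have h1 : Tendsto (fun k => (a * R (ms k)) ^ 3) atTop (𝓝 0) := by
          have := (hRms.const_mul a).pow 3
          simpa using this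
        have h2 : Tendsto (fun k => ENNReal.ofReal ((a * R (ms k)) ^ 3)) atTop (𝓝 0) := by
          have := ENNReal.tendsto_ofReal h1
          rwa [ENNReal.ofReal_zero] at this
        have h3 := ENNReal.Tendsto.mul_const h2 (Or.inr
          (measure_ball_lt_top (μ := (volume : Measure (EuclideanSpace ℝ (Fin 3))))
            (x := (0 : EuclideanSpace ℝ (Fin 3))) (r := 1)).ne)
        rwa [zero_mul] at h3
      exact tendsto_of_tendsto_of_tendsto_of_le_of_le tendsto_const_nhds hlim (fun k => bot_le) hvol
    have hT := tendsto_setLIntegral_zero hfin hsets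
    refine (hT.congr' ?_)
    filter_upwards [hev] with k hk
    simp only [hμ1]
    rw [Measure.restrict_restrict measurableSet_ball,
      inter_eq_left.2 (ball_subset_ball hk), hfb]
    have h := lintegral_ball_tangential_zoom b x₀ (hRpos (ms k)) a
    simp only [hτf, hV]
    exact h.symm
  -- (3) the limit is radial: the tangential defect vanishes a.e. on every annulus
  have hann : ∀ ε a : ℝ, 0 < ε → ε < a →
      ∀ᵐ y ∂(volume.restrict {y : EuclideanSpace ℝ (Fin 3) | ε ≤ ‖y‖ ∧ ‖y‖ ≤ a}), τf y (Vl y) = 0 := by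
    intro ε a hε hεa
    have ha : 0 < a := hε.trans hεa
    set A : Set (EuclideanSpace ℝ (Fin 3)) := {y | ε ≤ ‖y‖ ∧ ‖y‖ ≤ a} with hA
    have hAm : MeasurableSet A :=
      ((isClosed_le continuous_const continuous_norm).inter (isClosed_le continuous_norm continuous_const)).measurableSet
    have hAball : A ⊆ ball (0 : EuclideanSpace ℝ (Fin 3)) (a + 1) := fun y hy =>
      mem_ball_zero_iff.2 (by linarith [hy.2])
    have hApos : ∀ y ∈ A, 0 < ‖y‖ := fun y hy => hε.trans_le hy.1
    -- the tangential projection of the limit and the test field `h`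
    set P : EuclideanSpace ℝ (Fin 3) → EuclideanSpace ℝ (Fin 3) := fun y =>
      Vl y - (⟪y, Vl y⟫ / ‖y‖ ^ 2) • y with hP
    set h : EuclideanSpace ℝ (Fin 3) → EuclideanSpace ℝ (Fin 3) :=
      A.indicator fun y => (‖y‖⁻¹ : ℝ) • P y with hh
    have hym : Measurable fun y : EuclideanSpace ℝ (Fin 3) => y := measurable_id
    have hVlam : AEMeasurable Vl volume := hVlm.aemeasurable
    have hPnorm : ∀ y, ‖P y‖ ≤ 2 * ‖Vl y‖ := fun y => norm_tangentialProj_le (Vl y) y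
    have hPam : AEMeasurable P volume :=
      hVlam.sub (((hym.aemeasurable.inner hVlam).div (hym.norm.pow_const 2).aemeasurable).smul hym.aemeasurable)
    have hham : AEMeasurable h volume := ((hym.norm.inv.aemeasurable).smul hPam).indicator hAm
    have hhnorm : ∀ y, ‖h y‖ ≤ 2 * ε⁻¹ * (1 + (a + 1) ^ 2) *
        ‖(wl : EuclideanSpace ℝ (Fin 3) → EuclideanSpace ℝ (Fin 3)) y‖ := by
      intro y
      simp only [hh]
      by_cases hy : y ∈ A
      · rw [indicator_of_mem hy, norm_smul, Real.norm_eq_abs, abs_of_nonneg (inv_nonneg.2 (norm_nonneg _))]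
        have h1 : ‖y‖⁻¹ ≤ ε⁻¹ := inv_anti₀ hε hy.1
        have h2 := hVlbound y (hAball hy)
        calc ‖y‖⁻¹ * ‖P y‖ ≤ ε⁻¹ * (2 * ‖Vl y‖) :=
              mul_le_mul h1 (hPnorm y) (norm_nonneg _) (by positivity)
          _ ≤ ε⁻¹ * (2 * ((1 + (a + 1) ^ 2) * ‖(wl : EuclideanSpace ℝ (Fin 3) → EuclideanSpace ℝ (Fin 3)) y‖)) := by
              gcongr
          _ = 2 * ε⁻¹ * (1 + (a + 1) ^ 2) * ‖(wl : EuclideanSpace ℝ (Fin 3) → EuclideanSpace ℝ (Fin 3)) y‖ := by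
              ring
      · rw [indicator_of_notMem hy, norm_zero]; positivity
    have hhmem : MemLp h 2 volume := MemLp.of_le_mul hwlmem hham.aestronglyMeasurable (Eventually.of_forall hhnorm)
    have hhsupp : ∀ y, y ∉ ball (0 : EuclideanSpace ℝ (Fin 3)) (a + 1) → h y = 0 := fun y hy => by
      simp only [hh]; rw [indicator_of_notMem fun h' => hy (hAball h')]
    -- pairing identity: `⟪v, h y⟫ = 1_A |y|⁻¹ (⟪v, Vl y⟫ - ⟪y, v⟫⟪y, Vl y⟫/|y|²)`
    have hpairing : ∀ (v y : EuclideanSpace ℝ (Fin 3)), ⟪v, h y⟫ =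
        A.indicator (fun y => ‖y‖⁻¹ * (⟪v, Vl y⟫ - ⟪y, v⟫ * ⟪y, Vl y⟫ / ‖y‖ ^ 2)) y := by
      intro v y
      simp only [hh]
      by_cases hy : y ∈ A
      · rw [indicator_of_mem hy, indicator_of_mem hy]
        exact inner_smul_tangentialProj v (Vl y) y ‖y‖⁻¹
      · rw [indicator_of_notMem hy, indicator_of_notMem hy, inner_zero_right]
    -- the weighted tangential energies `Φ`
    have hΦint : ∀ {X : EuclideanSpace ℝ (Fin 3) → EuclideanSpace ℝ (Fin 3)},
        AEStronglyMeasurable X volume → IntegrableOn (fun y => ‖X y‖ ^ 2) (ball (0 : EuclideanSpace ℝ (Fin 3)) (a + 1)) →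
        IntegrableOn (fun y => ‖y‖⁻¹ * τf y (X y)) A := by
      intro X hXm hX2
      have hXam := hXm.aemeasurable
      refine Integrable.mono' ((hX2.mono_set hAball).const_mul ε⁻¹) ?_ ?_
      · exact ((hym.norm.inv.aemeasurable).mul ((hXam.norm.pow_const 2).sub
          (((hym.aemeasurable.inner hXam).pow_const 2).div (hym.norm.pow_const 2).aemeasurable))).aestronglyMeasurable.restrict
      · filter_upwards [ae_restrict_mem hAm] with y hy
        rw [Real.norm_eq_abs, abs_of_nonneg (mul_nonneg (inv_nonneg.2 (norm_nonneg _)) (hτnn y _))]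
        exact mul_le_mul (inv_anti₀ hε hy.1) (hτle y _) (hτnn y _) (by positivity)
    have hΦl := hΦint hVlm (hVl2 (a + 1))
    -- `Φ(V_k) → 0`
    have hV2k : ∀ k, IntegrableOn (fun y => ‖V (ms k) y‖ ^ 2) (ball (0 : EuclideanSpace ℝ (Fin 3)) (a + 1)) := by
      intro k
      refine ⟨(hVm (ms k)).norm.pow 2 |>.restrict, ?_⟩
      rw [hasFiniteIntegral_iff_enorm]
      have h := hVball (ms k) (a + 1) (by linarith)
      refine lt_of_le_of_lt (le_of_eq (lintegral_congr fun y => ?_)) (h.trans_lt ENNReal.ofReal_lt_top)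
      rw [Real.enorm_eq_ofReal (sq_nonneg _), ← ofReal_norm, ENNReal.ofReal_pow (norm_nonneg _)]
    have hΦk : ∀ k, IntegrableOn (fun y => ‖y‖⁻¹ * τf y (V (ms k) y)) A := fun k => hΦint (hVm (ms k)) (hV2k k)
    have hΦk0 : Tendsto (fun k => ∫ y in A, ‖y‖⁻¹ * τf y (V (ms k) y)) atTop (𝓝 0) := by
      have hle : ∀ k, ENNReal.ofReal (∫ y in A, ‖y‖⁻¹ * τf y (V (ms k) y)) ≤
          ∫⁻ y in ball (0 : EuclideanSpace ℝ (Fin 3)) (a + 1), ENNReal.ofReal (τf y (V (ms k) y) / ‖y‖) := by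
        intro k
        rw [ofReal_integral_eq_lintegral_ofReal (hΦk k) ?_]
        · refine (lintegral_mono_set hAball).trans (le_of_eq (lintegral_congr fun y => ?_))
          congr 1; rw [div_eq_inv_mul]
        · filter_upwards [ae_restrict_mem hAm] with y hy
          exact mul_nonneg (inv_nonneg.2 (norm_nonneg _)) (hτnn y _)
      have h0 := htend0 (a + 1) (by linarith)
      have h1 : Tendsto (fun k => ENNReal.ofReal (∫ y in A, ‖y‖⁻¹ * τf y (V (ms k) y))) atTop (𝓝 0) :=
        tendsto_of_tendsto_of_tendsto_of_le_of_le tendsto_const_nhds h0 (fun k => bot_le) hle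
      have hnn : ∀ k, 0 ≤ ∫ y in A, ‖y‖⁻¹ * τf y (V (ms k) y) := fun k =>
        setIntegral_nonneg hAm fun y _ => mul_nonneg (inv_nonneg.2 (norm_nonneg _)) (hτnn y _)
      have h2 := (ENNReal.tendsto_toReal ENNReal.zero_ne_top).comp h1
      rw [ENNReal.toReal_zero] at h2
      refine h2.congr fun k => ?_
      simp only [Function.comp]
      exact ENNReal.toReal_ofReal (hnn k)
    -- the duality inequality `2 ∫⟪V_k, h⟫ - Φ(Vl) ≤ Φ(V_k)`
    have hh2 : Integrable (fun y => ‖h y‖ ^ 2) volume := hhmem.integrable_norm_pow two_ne_zero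
    have hcrossint : ∀ k, IntegrableOn (fun y => ⟪V (ms k) y, h y⟫) A := by
      intro k
      refine Integrable.mono' ((((hV2k k).mono_set hAball).add hh2.integrableOn).div_const 2)
        (((hVm (ms k)).inner hhmem.aestronglyMeasurable).restrict) (Eventually.of_forall fun y => ?_)
      rw [Real.norm_eq_abs]
      have h1 := abs_real_inner_le_norm (V (ms k) y) (h y)
      have h2 : ‖V (ms k) y‖ * ‖h y‖ ≤ (‖V (ms k) y‖ ^ 2 + ‖h y‖ ^ 2) / 2 := by
        nlinarith [sq_nonneg (‖V (ms k) y‖ - ‖h y‖)]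
      exact h1.trans h2
    have hpairA : ∀ k, ∫ y, ⟪V (ms k) y, h y⟫ = ∫ y in A, ⟪V (ms k) y, h y⟫ := by
      intro k
      rw [← integral_indicator hAm]
      refine integral_congr_ae (Eventually.of_forall fun y => ?_)
      by_cases hy : y ∈ A
      · rw [indicator_of_mem hy]
      · simp only [hh]; rw [indicator_of_notMem hy, indicator_of_notMem hy, inner_zero_right]
    have hineq : ∀ k, 2 * (∫ y, ⟪V (ms k) y, h y⟫) - (∫ y in A, ‖y‖⁻¹ * τf y (Vl y)) ≤
        ∫ y in A, ‖y‖⁻¹ * τf y (V (ms k) y) := by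
      intro k
      rw [hpairA k, ← integral_const_mul, ← integral_sub ((hcrossint k).const_mul 2) hΦl]
      refine setIntegral_mono_on (((hcrossint k).const_mul 2).sub hΦl) (hΦk k) hAm fun y hy => ?_
      have hy0 : 0 < ‖y‖ := hApos y hy
      rw [hpairing, indicator_of_mem hy]
      have hd := tangential_duality_le (V (ms k) y) (Vl y) y
      simp only [hτf]
      have e : 2 * (‖y‖⁻¹ * (⟪V (ms k) y, Vl y⟫ - ⟪y, V (ms k) y⟫ * ⟪y, Vl y⟫ / ‖y‖ ^ 2)) -
          ‖y‖⁻¹ * (‖Vl y‖ ^ 2 - ⟪y, Vl y⟫ ^ 2 / ‖y‖ ^ 2) =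
          ‖y‖⁻¹ * (2 * (⟪V (ms k) y, Vl y⟫ - ⟪y, V (ms k) y⟫ * ⟪y, Vl y⟫ / ‖y‖ ^ 2) -
            (‖Vl y‖ ^ 2 - ⟪y, Vl y⟫ ^ 2 / ‖y‖ ^ 2)) := by ring
      rw [e]
      exact mul_le_mul_of_nonneg_left hd (inv_nonneg.2 hy0.le)
    -- the limit of the pairings is `Φ(Vl)`
    have hlimpair : Tendsto (fun k => ∫ y, ⟪V (ms k) y, h y⟫) atTop (𝓝 (∫ y, ⟪Vl y, h y⟫)) :=
      hpair hhmem hhsupp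
    have hself : ∫ y, ⟪Vl y, h y⟫ = ∫ y in A, ‖y‖⁻¹ * τf y (Vl y) := by
      rw [← integral_indicator hAm]
      refine integral_congr_ae (Eventually.of_forall fun y => ?_)
      show ⟪Vl y, h y⟫ = A.indicator (fun y => ‖y‖⁻¹ * τf y (Vl y)) y
      rw [hpairing]
      by_cases hy : y ∈ A
      · rw [indicator_of_mem hy, indicator_of_mem hy]
        simp only [hτf, real_inner_self_eq_norm_sq]
        ring
      · rw [indicator_of_notMem hy, indicator_of_notMem hy]
    have hΦl_le : ∫ y in A, ‖y‖⁻¹ * τf y (Vl y) ≤ 0 := by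
      have h1 : Tendsto (fun k => 2 * (∫ y, ⟪V (ms k) y, h y⟫) - (∫ y in A, ‖y‖⁻¹ * τf y (Vl y))) atTop
          (𝓝 (2 * (∫ y in A, ‖y‖⁻¹ * τf y (Vl y)) - ∫ y in A, ‖y‖⁻¹ * τf y (Vl y))) := by
        rw [← hself]
        exact (hlimpair.const_mul 2).sub_const _
      have h2 := le_of_tendsto_of_tendsto h1 hΦk0 (Eventually.of_forall hineq)
      linarith
    have hΦl_nn : 0 ≤ᵐ[volume.restrict A] fun y => ‖y‖⁻¹ * τf y (Vl y) := by
      filter_upwards [ae_restrict_mem hAm] with y hy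
      exact mul_nonneg (inv_nonneg.2 (norm_nonneg _)) (hτnn y _)
    have hzero : (fun y => ‖y‖⁻¹ * τf y (Vl y)) =ᵐ[volume.restrict A] 0 :=
      (integral_eq_zero_iff_of_nonneg_ae hΦl_nn hΦl).1 (le_antisymm hΦl_le (integral_nonneg_of_ae hΦl_nn))
    filter_upwards [hzero, ae_restrict_mem hAm] with y hy hyA
    have hy0 : 0 < ‖y‖ := hApos y hyA
    have := hy
    simp only [Pi.zero_apply, mul_eq_zero, inv_eq_zero, norm_eq_zero] at this
    rcases this with h0 | h0
    · exact absurd h0 (norm_pos_iff.1 hy0)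
    · exact h0
  have hrad : ∀ᵐ y ∂(volume : Measure (EuclideanSpace ℝ (Fin 3))), (‖y‖ ^ 2) • Vl y = ⟪Vl y, y⟫ • y := by
    -- a.e. on `{y ≠ 0}` through the annuli `{1/(n+2) ≤ |y| ≤ n+1}`
    have hn : ∀ n : ℕ, ∀ᵐ y ∂volume, y ∈ {y : EuclideanSpace ℝ (Fin 3) |
        (1 : ℝ) / ((n : ℝ) + 2) ≤ ‖y‖ ∧ ‖y‖ ≤ (n : ℝ) + 1} → τf y (Vl y) = 0 := by
      intro n
      have hAm : MeasurableSet {y : EuclideanSpace ℝ (Fin 3) | (1 : ℝ) / ((n : ℝ) + 2) ≤ ‖y‖ ∧ ‖y‖ ≤ (n : ℝ) + 1} :=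
        ((isClosed_le continuous_const continuous_norm).inter (isClosed_le continuous_norm continuous_const)).measurableSet
      rw [← ae_restrict_iff' hAm]
      refine hann _ _ (by positivity) ?_
      have : (1 : ℝ) / ((n : ℝ) + 2) ≤ 1 / 2 := one_div_le_one_div_of_le (by norm_num) (by linarith [(n.cast_nonneg : (0:ℝ) ≤ n)])
      linarith [(n.cast_nonneg : (0 : ℝ) ≤ n)]
    have hall := ae_all_iff.2 hn
    have h0 : ∀ᵐ y ∂(volume : Measure (EuclideanSpace ℝ (Fin 3))), y ≠ 0 := by
      have : (volume : Measure (EuclideanSpace ℝ (Fin 3))) {0} = 0 := measure_singleton 0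
      rw [ae_iff]
      simp [this]
    filter_upwards [hall, h0] with y hy hy0
    have hρ : 0 < ‖y‖ := norm_pos_iff.2 hy0
    -- pick `n` with `1/(n+2) ≤ |y| ≤ n+1`
    obtain ⟨n₁, hn₁⟩ := exists_nat_one_div_lt hρ
    obtain ⟨n₂, hn₂⟩ := exists_nat_gt ‖y‖
    set n := max n₁ n₂ with hndef
    have h1 : (1 : ℝ) / ((n : ℝ) + 2) ≤ ‖y‖ := by
      have : (1 : ℝ) / ((n : ℝ) + 2) ≤ 1 / ((n₁ : ℝ) + 1) := by
        apply one_div_le_one_div_of_le (by positivity)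
        have : (n₁ : ℝ) ≤ n := by exact_mod_cast le_max_left n₁ n₂
        linarith
      linarith
    have h2 : ‖y‖ ≤ (n : ℝ) + 1 := by
      have : (n₂ : ℝ) ≤ n := by exact_mod_cast le_max_right n₁ n₂
      linarith
    exact radial_of_tangential_eq_zero hy0 (hy n ⟨h1, h2⟩)
  -- (4) the limit vanishes, and so do the pairings with `φ`
  have hVl0 : Vl =ᵐ[volume] 0 :=
    ae_eq_zero_of_isWeaklyDivFree_of_radial hVlloc hdivVl hrad (hVl2 1)
  refine ⟨ms, hms, ?_⟩
  have hlim := hpair hφ hφs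
  have h0 : ∫ y, ⟪Vl y, φ y⟫ = 0 := by
    rw [← integral_zero]
    refine integral_congr_ae ?_
    filter_upwards [hVl0] with y hy
    rw [hy, Pi.zero_apply, inner_zero_left]
  rw [h0] at hlim
  exact hlim

/-- **Zooms of a finite-energy, weakly divergence-free profile with finite log-tangential energy
at `x₀` converge weakly to zero** (see the module docstring): for every compactly supported
square-integrable `φ` and every sequence `R_j → 0⁺`, `∫ ⟪R_j b(x₀ + R_j y), φ(y)⟫ dy → 0`.
[cite: SereginSverak2002, §4] -/
theorem tendsto_integral_inner_zoom
    {b : EuclideanSpace ℝ (Fin 3) → EuclideanSpace ℝ (Fin 3)} (hb2 : MemLp b 2)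
    (hdiv : IsWeaklyDivFree b) (x₀ : EuclideanSpace ℝ (Fin 3)) {M r₀ : ℝ} (hM : 0 ≤ M) (hr₀ : 0 < r₀)
    (hMorrey : ∀ r, 0 < r → r ≤ r₀ → ∫ x in ball x₀ r, ‖b x‖ ^ 2 ≤ M * r)
    (htan : ∫⁻ x in ball x₀ 1, ENNReal.ofReal
      ((‖b x‖ ^ 2 - ⟪x - x₀, b x⟫ ^ 2 / ‖x - x₀‖ ^ 2) / ‖x - x₀‖) ≠ ⊤)
    {φ : EuclideanSpace ℝ (Fin 3) → EuclideanSpace ℝ (Fin 3)} (hφ : MemLp φ 2) {ρφ : ℝ}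
    (hφs : ∀ y, y ∉ ball (0 : EuclideanSpace ℝ (Fin 3)) ρφ → φ y = 0)
    {R : ℕ → ℝ} (hRpos : ∀ j, 0 < R j) (hR0 : Tendsto R atTop (𝓝 0)) :
    Tendsto (fun j => ∫ y, ⟪R j • b (x₀ + R j • y), φ y⟫) atTop (𝓝 0) := by
  refine tendsto_of_subseq_tendsto fun ns hns => ?_
  obtain ⟨ms, -, hms⟩ := exists_subseq_tendsto_integral_inner_zoom hb2 hdiv x₀ hM hr₀ hMorrey htan hφ hφs
    (R := fun k => R (ns k)) (fun k => hRpos _) (hR0.comp hns)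
  exact ⟨ms, hms⟩

end WeakLimit

end SereginSverak2002

end Literature.Analysis.FluidPDE

end
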